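/-
Copyright (c) 2026 the pub-hodgecm-mathlib formalisation cell (harness21).  Prover seat hodgecm-mathlib-LH3-p03 (g4) on line LH3 (closer stub `stub_N9`, N9 «Transf» direct
road), organ J, brick (G′-CANCEL): the semiregular-point PACKAGE — every block binder in one `obtain`, and `K = Kβ` from the raw hypotheses; 2026-09-02.
-/
import Literature.NumberTheory.Rogawski1990.ArchChartOrbGBlockDescentsBoxes                   -- ★ p850673∕p850700 (this seat): `exists_hmap_hmapβ_descentConst_eq_of_clauses`, `fst_std_gprimeTorus_insert_eq_hypBlockGL`
import Literature.NumberTheory.Automorphic.ArchSharedRankOneDatumTorus                        -- ★ p850769 (this seat): `ne_zero_of_sharedA0`, `exists_isHaarMeasure_isInvInvariant_torusU_box`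
import Literature.NumberTheory.Automorphic.ArchInnerFormSemiregularCentralizerBlockCayleyTorus -- ★ p850682 (LH5-p02 (g3)) (M-UNFOLD) torus edition: [1]–[10], [5β], [6β], [7β]
import Literature.NumberTheory.Automorphic.ArchInnerFormSemiregularSplitTorusStd               -- ★ p850743 (LH5-p02 (g3)) (b2): `hTAβ_package_semireg_std`
import Literature.NumberTheory.Rogawski1990.ArchOrbFamGExtJumpSideAssembly                    -- ★ p850629∕p850677 (LH3-p02 (g3)): `exists_std_package`, `blockWeights_of_mem_splitChartPlaces`, `isCompact_map_circleDiagonal_range`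
import HarnessLib

/-!
# (G′-CANCEL) AT A SEMIREGULAR POINT: the standardised block package in ONE `obtain`, and `K = Kβ` from the raw hypotheses and the shared datum
# (Rogawski 1990 §8.2 p. 122, §4.12; Folland 1995 §2.6; Deitmar–Echterhoff 2014 Thm. 1.5.3)

Topic `NumberTheory/Rogawski1990`; namespace `Literature.NumberTheory.Rogawski1990`.  THEOREMS ONLY (no `def`, no instance, no notation, no axiom, no named fact, no `sorry`);
kernel lane `--kind proof --supports stmt-HodgeConjecture-24833`.  Cell `pub/hodgecm-mathlib`, crux H413 (`stmt-HodgeConjecture-24833`), F0∕P3c line LH3 (closer stub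
`stub_N9`, DIRECT ROAD, organ J, residual `stub_N9jumpGSide : JumpGSideStatement` of skeleton v3.6 — LH3-p02 (g3)'s head `orbFamGExt_jumpGSideStatement`), brick
**(G′-CANCEL) INTEGRATION** (seat LH3-p03 (g4)).  The (G′) head binds, at every semiregular compact-wall point `s = gprimeTorus α S p`, ONE standardised block splitting
`e′ : Z(s) ≃ₜ* U(J) × K` with the clauses of five ★ files by four seats: ★ p850682 (M-UNFOLD torus edition, LH5-p02), ★ `exists_std_package` (B-STD, LH3-p02), ★ `hTAβ_package_semireg_std`
((b2), LH5-p02), ★ `fst_std_gprimeTorus_insert_eq_hypBlockGL` and ★ `exists_hmap_hmapβ_descentConst_eq_of_clauses` (this seat).  §1 packages them (STAGE A): ONE `obtain` gives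
`K e φ e′ Ψ Ψβ` with EVERY clause any organ-J consumer binds, for the SAME `e′`.  §2 supplies the last two binders of ★ `…_of_clauses` at `A := φ(range cD)` (`CompactSpace`, commutativity); with ★ p850769 (the `σ` binder from the datum) the (G′) head's
`K = Kβ` is then `exists_hmap_hmapβ_descentConst_eq_of_clauses` applied to §1's outputs token for token (certified GREEN at HOME as one `theorem`, 31 s; not re-landed: the gate reads it
as a restatement of ★ `…_of_clauses`).
HONEST LABEL: HC_CM is proved only modulo the 7 printed citations (2 remaining named inputs: hLiu418 = `stmt-HodgeConjecture-24832`, h413 = `stmt-HodgeConjecture-24833`) until rung 0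
closes; count-neutral re-packaging under organ J of `stub_N9` (no new mathematics: `obtain`s and one `CompactSpace`∕commutativity check of the Cayley torus).

## References
* [Rogawski1990] J. D. Rogawski, *Automorphic Representations of Unitary Groups in Three Variables*, Ann. of Math. Stud. 123 (1990), §3.6 p. 31, §4.12 Lemma 4.12.1 p. 66, §8.2 p. 122.
* [Folland1995] G. B. Folland, *A Course in Abstract Harmonic Analysis* (1995), §2.2, §2.6 Thm. 2.49, (2.52).
* [DeitmarEchterhoff2014] A. Deitmar, S. Echterhoff, *Principles of Harmonic Analysis*, 2nd ed. (2014), Thm. 1.5.3.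
* [PlatonovRapinchuk1994] V. Platonov, A. Rapinchuk, *Algebraic Groups and Number Theory* (1994), §2.3.
-/

set_option autoImplicit false

noncomputable section

open MeasureTheory MeasureTheory.Measure Set Topology NumberField NumberField.InfinitePlace Filter Complex
open Literature.MeasureTheory.Group Literature.NumberTheory.Automorphic Literature.NumberTheory.Automorphic.UnitaryGroup
open Literature.NumberTheory.Automorphic.Shelstad1979.StableOrbitalIntegrals
open scoped MatrixGroups Matrix NNReal ENNReal Real Classical

namespace Literature.NumberTheory.Rogawski1990

/-! ## §1 STAGE A — ONE standardised block splitting `e′` carrying every clause the G′ head binds (★ p850682 ∘ ★ `exists_std_package` ∘ ★ `hTAβ_package_semireg_std` ∘ ★ ED. 2) -/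

section StageA

variable (L : Type) [Field L] [NumberField L] [IsCMField L] (α : Fin 3 → L)
  (S : Finset {w : InfinitePlace L // IsComplex w}) (w₀ : {w : InfinitePlace L // IsComplex w}) (p : {w : InfinitePlace L // IsComplex w} → Fin 3 → ℝ)
  (hα : ∀ i, α i ≠ 0) (hS : ∀ w, w ∈ S → w ∈ splitChartPlaces L α)
  (hw₀ : w₀ ∉ S) (hsp : w₀ ∈ splitChartPlaces L α) (hp : p w₀ 0 = p w₀ 2) (h01 : Circle.exp (p w₀ 0) ≠ Circle.exp (p w₀ 1))
  (hreg : ∀ w, w ≠ w₀ → w ∉ S → Function.Injective fun i : Fin 3 => Circle.exp (p w i)) (hregS : ∀ w, w ∈ S → p w 0 ≠ 0)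
  {J : Matrix (Fin 2) (Fin 2) ℂ} (hJ : J = (StdForm.antidiagonal 2).over ℂ)
  (hsgn : (w₀.1.embedding (![α (lineOf (formSign L α w₀) 0), α (lineOf (formSign L α w₀) 2)] 0)).re *
    (w₀.1.embedding (![α (lineOf (formSign L α w₀) 0), α (lineOf (formSign L α w₀) 2)] 1)).re < 0)

set_option maxHeartbeats 1600000 in
include hα hS h01 hreg hregS in
/-- **STAGE A — THE STANDARDISED BLOCK PACKAGE AT A SEMIREGULAR COMPACT-WALL POINT, EVERY CLAUSE IN ONE `obtain`.**  At `s = gprimeTorus α S p` (`w₀ ∉ S` a split-chart place,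
REAL wall `p w₀ 0 = p w₀ 2`, `p` regular elsewhere), with `hsgn` the opposite-sign weights (★ `blockWeights_of_mem_splitChartPlaces hsp`, applied-vector spelling): there are
`K ≤ Z(s)`, ★ (M-UNFOLD)'s `e : Z(s) ≃ₜ* B_{w₀} × K` (torus edition ★ p850682), (B-STD)'s `φ : B_{w₀} ≃ₜ* U(J)`, the standardised `e′ : Z(s) ≃ₜ* U(J) × K` and the two quotient
homeomorphisms `Ψ` (compact torus, `A = φ(range cD)`) and `Ψβ` (Cayley torus, `torusU`) such that: [1] [3] [4] [5] [6] [7] [8] [10] [5β] [6β] [7β] (★ p850682 VERBATIM), `hφ`∕`hval` (★ p850476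
(i)(ii)), `e′ g = (φ (e g).1, (e g).2)`, `(e′ γ♯_c).1 = hypBlockGL (c w₀ 0) (c w₀ 2)` (★ `fst_std_gprimeTorus_insert_eq_hypBlockGL`), the two membership clauses `hTA`∕`hTAβ`,
and `Ψ ⟦g⟧ = ⟦(e′ g).1⟧`, `Ψ⁻¹ ⟦b⟧ = ⟦e′⁻¹(b,1)⟧`, same for `Ψβ` — i.e. EVERY block binder of ★ `exists_hmap_hmapβ_descentConst_eq_of_clauses`, of ★ p850492 (`hγ`), of ★
`eM_gprimeTorus_insert_cayRay_eq` (`hγβ`) and of ★ p850417∕p850444, for ONE `e′`.  (Pure re-packaging of ★ p850682, ★ `exists_std_package`, ★ `hTAβ_package_semireg_std`.)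
[cite: Rogawski1990, §8.2 p. 122; §4.12; §3.6 p. 31] [cite: PlatonovRapinchuk1994, §2.3] [cite: Folland1995, §2.6] -/
theorem exists_stdBlock_clauses_semireg :
    ∃ (K : Subgroup ↥(Subgroup.centralizer ({gprimeTorus L α S p} : Set ↥(arch (↥(maximalRealSubfield L)) L (IsCMField.complexConj L) 3 (Matrix.diagonal α)))))
      (e : ↥(Subgroup.centralizer ({gprimeTorus L α S p} : Set ↥(arch (↥(maximalRealSubfield L)) L (IsCMField.complexConj L) 3 (Matrix.diagonal α)))) ≃ₜ* ↥(unitaryGroupOfForm (starRingEnd ℂ) ((Matrix.diagonal ![α (lineOf (formSign L α w₀) 0), α (lineOf (formSign L α w₀) 2)]).map w₀.1.embedding)) × ↥K)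
      (φ : ↥(unitaryGroupOfForm (starRingEnd ℂ) ((Matrix.diagonal ![α (lineOf (formSign L α w₀) 0), α (lineOf (formSign L α w₀) 2)]).map w₀.1.embedding)) ≃ₜ* ↥(unitaryGroupOfForm (starRingEnd ℂ) J))
      (e' : ↥(Subgroup.centralizer ({gprimeTorus L α S p} : Set ↥(arch (↥(maximalRealSubfield L)) L (IsCMField.complexConj L) 3 (Matrix.diagonal α)))) ≃ₜ* ↥(unitaryGroupOfForm (starRingEnd ℂ) J) × ↥K)
      (Ψ : (↥(Subgroup.centralizer ({gprimeTorus L α S p} : Set ↥(arch (↥(maximalRealSubfield L)) L (IsCMField.complexConj L) 3 (Matrix.diagonal α)))) ⧸ (chartTorusG L α S).subgroupOf (Subgroup.centralizer ({gprimeTorus L α S p} : Set ↥(arch (↥(maximalRealSubfield L)) L (IsCMField.complexConj L) 3 (Matrix.diagonal α))))) ≃ₜ ↥(unitaryGroupOfForm (starRingEnd ℂ) J) ⧸ Subgroup.map (φ : ↥(unitaryGroupOfForm (starRingEnd ℂ) ((Matrix.diagonal ![α (lineOf (formSign L α w₀) 0), α (lineOf (formSign L α w₀) 2)]).map w₀.1.embedding))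 →* ↥(unitaryGroupOfForm (starRingEnd ℂ) J)) ((circleDiagonal 2).codRestrict (unitaryGroupOfForm (starRingEnd ℂ) ((Matrix.diagonal ![α (lineOf (formSign L α w₀) 0), α (lineOf (formSign L α w₀) 2)]).map w₀.1.embedding)) (circleDiagonal_mem_archLocal_diagonal L 2 ![α (lineOf (formSign L α w₀) 0), α (lineOf (formSign L α w₀) 2)] w₀)).range)
      (Ψβ : (↥(Subgroup.centralizer ({gprimeTorus L α S p} : Set ↥(arch (↥(maximalRealSubfield L)) L (IsCMField.complexConj L) 3 (Matrix.diagonal α)))) ⧸ (chartTorusG L α (insert w₀ S)).subgroupOf (Subgroup.centralizer ({gprimeTorus L α S p} : Set ↥(arch (↥(maximalRealSubfield L)) L (IsCMField.complexConj L) 3 (Matrix.diagonal α))))) ≃ₜ ↥(unitaryGroupOfForm (starRingEnd ℂ) J) ⧸ torusU (starRingEnd ℂ) J),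
      -- [1] [3] [4] [5] [6] [7] [8] [10]
      IsClosed (K : Set ↥(Subgroup.centralizer ({gprimeTorus L α S p} : Set ↥(arch (↥(maximalRealSubfield L)) L (IsCMField.complexConj L) 3 (Matrix.diagonal α))))) ∧
      (∀ k₁, k₁ ∈ K → ∀ k₂, k₂ ∈ K → k₁ * k₂ = k₂ * k₁) ∧
      (∀ g : ↥(Subgroup.centralizer ({gprimeTorus L α S p} : Set ↥(arch (↥(maximalRealSubfield L)) L (IsCMField.complexConj L) 3 (Matrix.diagonal α)))), (g : ↥(arch (↥(maximalRealSubfield L)) L (IsCMField.complexConj L) 3 (Matrix.diagonal α))) ∈ chartTorusG L α S ↔ ((e g).1 : GL (Fin 2) ℂ) ∈ Set.range (circleDiagonal 2)) ∧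
      (∀ c : {w : InfinitePlace L // IsComplex w} → Fin 3 → ℝ, ((e ⟨gprimeTorus L α S c, gprimeTorus_mem_centralizer L α S p c⟩).1 : GL (Fin 2) ℂ) = circleDiagonal 2 ![Circle.exp (c w₀ 0), Circle.exp (c w₀ 2)]) ∧
      (∀ c : {w : InfinitePlace L // IsComplex w} → Fin 3 → ℝ, (((e ⟨gprimeTorus L α S c, gprimeTorus_mem_centralizer L α S p c⟩).2 : ↥(Subgroup.centralizer ({gprimeTorus L α S p} : Set ↥(arch (↥(maximalRealSubfield L)) L (IsCMField.complexConj L) 3 (Matrix.diagonal α))))) : ↥(arch (↥(maximalRealSubfield L)) L (IsCMField.complexConj L) 3 (Matrix.diagonal α))) = gprimeTorus L α S (Function.update c w₀ ![0, c w₀ 1, 0])) ∧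
      Subgroup.map (e : ↥(Subgroup.centralizer ({gprimeTorus L α S p} : Set ↥(arch (↥(maximalRealSubfield L)) L (IsCMField.complexConj L) 3 (Matrix.diagonal α)))) →* ↥(unitaryGroupOfForm (starRingEnd ℂ) ((Matrix.diagonal ![α (lineOf (formSign L α w₀) 0), α (lineOf (formSign L α w₀) 2)]).map w₀.1.embedding)) × ↥K) ((chartTorusG L α S).subgroupOf (Subgroup.centralizer ({gprimeTorus L α S p} : Set ↥(arch (↥(maximalRealSubfield L)) L (IsCMField.complexConj L) 3 (Matrix.diagonal α))))) = (((circleDiagonal 2).codRestrict (unitaryGroupOfForm (starRingEnd ℂ) ((Matrix.diagonal ![α (lineOf (formSign L α w₀) 0), α (lineOf (formSign L α w₀) 2)]).map w₀.1.embedding)) (circleDiagonal_mem_archLocal_diagonal L 2 ![α (lineOf (formSign L α w₀) 0), α (lineOf (formSign L α w₀) 2)] w₀)).range).prod ⊤ ∧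
      (∀ b : ↥(unitaryGroupOfForm (starRingEnd ℂ) ((Matrix.diagonal ![α (lineOf (formSign L α w₀) 0), α (lineOf (formSign L α w₀) 2)]).map w₀.1.embedding)), ((e.symm (b, 1) : ↥(Subgroup.centralizer ({gprimeTorus L α S p} : Set ↥(arch (↥(maximalRealSubfield L)) L (IsCMField.complexConj L) 3 (Matrix.diagonal α))))) : ↥(arch (↥(maximalRealSubfield L)) L (IsCMField.complexConj L) 3 (Matrix.diagonal α))) =
          (archPiEquivCM 3 L (Matrix.diagonal α)).symm (Pi.mulSingle w₀
            ((ContinuousMulEquiv.restrictSubgroup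
            (GLn.conjEquiv (Matrix.GeneralLinearGroup.mkOfDetNeZero _ (det_monomial_one_ne_zero 3 (lineOf (formSign L α w₀)))))
            (archLocal L 3 (Matrix.diagonal (α ∘ (lineOf (formSign L α w₀)))) w₀) (archLocal L 3 (Matrix.diagonal α) w₀)
            (mem_archLocal_comp_perm_iff_conj_mem L 3 α w₀ (lineOf (formSign L α w₀))))
              ((endoEmb (starRingEnd ℂ) ((Matrix.diagonal ![(α ∘ (lineOf (formSign L α w₀))) 0, (α ∘ (lineOf (formSign L α w₀))) 2]).map w₀.1.embedding)
              ((Matrix.diagonal ![(α ∘ (lineOf (formSign L α w₀))) 1]).map w₀.1.embedding) ((Matrix.diagonal (α ∘ (lineOf (formSign L α w₀)))).map w₀.1.embedding)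
              (endoForm_archLocal_diagonal L (α ∘ (lineOf (formSign L α w₀))) w₀)) (b, 1))))) ∧
      (∀ k : ↥(Subgroup.centralizer ({gprimeTorus L α S p} : Set ↥(arch (↥(maximalRealSubfield L)) L (IsCMField.complexConj L) 3 (Matrix.diagonal α)))), ∀ hk : k ∈ K, e k = (1, ⟨k, hk⟩)) ∧
      -- [5β] [6β] [7β]
      (∀ c : {w : InfinitePlace L // IsComplex w} → Fin 3 → ℝ, ((((e ⟨gprimeTorus L α (insert w₀ S) c, gprimeTorus_insert_mem_centralizer L α hw₀ hsp hp c⟩).1 : ↥(unitaryGroupOfForm (starRingEnd ℂ) ((Matrix.diagonal ![α (lineOf (formSign L α w₀) 0), α (lineOf (formSign L α w₀) 2)]).map w₀.1.embedding))) : GL (Fin 2) ℂ) : Matrix (Fin 2) (Fin 2) ℂ) =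
          (boostStd (formRe L α w₀ ∘ (lineOf (formSign L α w₀))) (c w₀)).submatrix ![0, 2] ![0, 2]) ∧
      (∀ c : {w : InfinitePlace L // IsComplex w} → Fin 3 → ℝ, ((((e ⟨gprimeTorus L α (insert w₀ S) c, gprimeTorus_insert_mem_centralizer L α hw₀ hsp hp c⟩).2 : ↥K) : ↥(Subgroup.centralizer ({gprimeTorus L α S p} : Set ↥(arch (↥(maximalRealSubfield L)) L (IsCMField.complexConj L) 3 (Matrix.diagonal α))))) : ↥(arch (↥(maximalRealSubfield L)) L (IsCMField.complexConj L) 3 (Matrix.diagonal α))) =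
          gprimeTorus L α S (Function.update c w₀ ![0, c w₀ 1, 0])) ∧
      (∀ g : ↥(Subgroup.centralizer ({gprimeTorus L α S p} : Set ↥(arch (↥(maximalRealSubfield L)) L (IsCMField.complexConj L) 3 (Matrix.diagonal α)))), (g : ↥(arch (↥(maximalRealSubfield L)) L (IsCMField.complexConj L) 3 (Matrix.diagonal α))) ∈ chartTorusG L α (insert w₀ S) ↔
          ∃ x θ : ℝ, ((((e g).1 : ↥(unitaryGroupOfForm (starRingEnd ℂ) ((Matrix.diagonal ![α (lineOf (formSign L α w₀) 0), α (lineOf (formSign L α w₀) 2)]).map w₀.1.embedding))) : GL (Fin 2) ℂ) : Matrix (Fin 2) (Fin 2) ℂ) = (boostStd (formRe L α w₀ ∘ (lineOf (formSign L α w₀))) ![x, 0, θ]).submatrix ![0, 2] ![0, 2]) ∧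
      -- (B-STD) (i) (ii), `e′`, [5β] through `φ`
      (∀ u : Fin 2 → Circle, φ ⟨circleDiagonal 2 u, circleDiagonal_mem_unitaryGroupOfForm_diagonal_map_weights w₀.1.embedding ![α (lineOf (formSign L α w₀) 0), α (lineOf (formSign L α w₀) 2)] u⟩ =
          ⟨Matrix.GeneralLinearGroup.mkOfDetNeZero !![(1 : ℂ), 1; 1, -1] det_cayleyTwo_ne_zero * circleDiagonal 2 u * (Matrix.GeneralLinearGroup.mkOfDetNeZero !![(1 : ℂ), 1; 1, -1] det_cayleyTwo_ne_zero)⁻¹, cayley_conj_circleDiagonal_mem_of_eq_over hJ u⟩) ∧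
      (∀ h : ↥(unitaryGroupOfForm (starRingEnd ℂ) ((Matrix.diagonal ![α (lineOf (formSign L α w₀) 0), α (lineOf (formSign L α w₀) 2)]).map w₀.1.embedding)), ((φ h : ↥(unitaryGroupOfForm (starRingEnd ℂ) J)) : GL (Fin 2) ℂ) = Matrix.GeneralLinearGroup.mkOfDetNeZero !![(1 : ℂ), 1; 1, -1] det_cayleyTwo_ne_zero * Matrix.GeneralLinearGroup.mkOfDetNeZero (Matrix.diagonal ![((Real.sqrt (|(w₀.1.embedding (![α (lineOf (formSign L α w₀) 0), α (lineOf (formSign L α w₀) 2)] 0)).re| / 2) : ℝ) : ℂ), ((Real.sqrt (|(w₀.1.embedding (![α (lineOf (formSign L α w₀) 0), α (lineOf (formSign L α w₀) 2)] 1)).re| / 2) : ℝ) : ℂ)]) (det_blockScale_ne_zero _ _ hsgn) * (h : GL (Fin 2) ℂ) * (Matrix.GeneralLinearGroup.mkOfDetNeZero !![(1 : ℂ), 1; 1, -1] det_cayleyTwo_ne_zero * Matrix.GeneralLinearGroup.mkOfDetNeZero (Matrix.diagonal ![((Real.sqrt (|(w₀.1.embedding (![α (lineOf (formSign L α w₀)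 0), α (lineOf (formSign L α w₀) 2)] 0)).re| / 2) : ℝ) : ℂ), ((Real.sqrt (|(w₀.1.embedding (![α (lineOf (formSign L α w₀) 0), α (lineOf (formSign L α w₀) 2)] 1)).re| / 2) : ℝ) : ℂ)]) (det_blockScale_ne_zero _ _ hsgn))⁻¹) ∧
      (∀ g, e' g = (φ (e g).1, (e g).2)) ∧
      (∀ c : {w : InfinitePlace L // IsComplex w} → Fin 3 → ℝ, (e' ⟨gprimeTorus L α (insert w₀ S) c, gprimeTorus_insert_mem_centralizer L α hw₀ hsp hp c⟩).1 =
          ⟨hypBlockGL (c w₀ 0) (c w₀ 2), hypBlockGL_mem_of_eq_over hJ (c w₀ 0) (c w₀ 2)⟩) ∧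
      -- the two tori through `e′`, and the quotient homeomorphisms
      (∀ g : ↥(Subgroup.centralizer ({gprimeTorus L α S p} : Set ↥(arch (↥(maximalRealSubfield L)) L (IsCMField.complexConj L) 3 (Matrix.diagonal α)))), g ∈ (chartTorusG L α S).subgroupOf (Subgroup.centralizer ({gprimeTorus L α S p} : Set ↥(arch (↥(maximalRealSubfield L)) L (IsCMField.complexConj L) 3 (Matrix.diagonal α)))) ↔ (e' g).1 ∈ Subgroup.map (φ : ↥(unitaryGroupOfForm (starRingEnd ℂ) ((Matrix.diagonal ![α (lineOf (formSign L α w₀) 0), α (lineOf (formSign L α w₀) 2)]).map w₀.1.embedding)) →* ↥(unitaryGroupOfForm (starRingEnd ℂ) J)) ((circleDiagonal 2).codRestrict (unitaryGroupOfForm (starRingEnd ℂ) ((Matrix.diagonal ![α (lineOf (formSign L α w₀) 0), α (lineOf (formSign L α w₀) 2)]).map w₀.1.embedding)) (circleDiagonal_mem_archLocal_diagonal L 2 ![α (lineOf (formSign L α w₀) 0), α (lineOf (formSign L α w₀) 2)] w₀)).range) ∧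
      (∀ g : ↥(Subgroup.centralizer ({gprimeTorus L α S p} : Set ↥(arch (↥(maximalRealSubfield L)) L (IsCMField.complexConj L) 3 (Matrix.diagonal α)))), g ∈ (chartTorusG L α (insert w₀ S)).subgroupOf (Subgroup.centralizer ({gprimeTorus L α S p} : Set ↥(arch (↥(maximalRealSubfield L)) L (IsCMField.complexConj L) 3 (Matrix.diagonal α)))) ↔ (e' g).1 ∈ torusU (starRingEnd ℂ) J) ∧
      (∀ g : ↥(Subgroup.centralizer ({gprimeTorus L α S p} : Set ↥(arch (↥(maximalRealSubfield L)) L (IsCMField.complexConj L) 3 (Matrix.diagonal α)))), Ψ (QuotientGroup.mk g) = QuotientGroup.mk (e' g).1) ∧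
      (∀ b : ↥(unitaryGroupOfForm (starRingEnd ℂ) J), Ψ.symm (QuotientGroup.mk b) = QuotientGroup.mk (e'.symm (b, 1))) ∧
      (∀ g : ↥(Subgroup.centralizer ({gprimeTorus L α S p} : Set ↥(arch (↥(maximalRealSubfield L)) L (IsCMField.complexConj L) 3 (Matrix.diagonal α)))), Ψβ (QuotientGroup.mk g) = QuotientGroup.mk (e' g).1) ∧
      (∀ b : ↥(unitaryGroupOfForm (starRingEnd ℂ) J), Ψβ.symm (QuotientGroup.mk b) = QuotientGroup.mk (e'.symm (b, 1))) := by
  obtain ⟨K, e, h1, -, h3, h4, h5, h6, h7, h8, -, h10, h5β, h6β, h7β⟩ :=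
    exists_continuousMulEquiv_centralizer_gprimeTorus_semireg_cayley_torus L α S w₀ hα hS hw₀ hsp p hp h01 hreg hregS
  have hreal2 := (blockWeights_of_mem_splitChartPlaces L α w₀ hsp).1
  obtain ⟨φ, e', Ψ, hφ, hval, he', -, hTA, hΨ1, hΨ⟩ := exists_std_package L α w₀ hJ hreal2 hsgn e _ _ h7
  obtain ⟨hTAβ, -, Ψβ, hΨβ1, hΨβ⟩ := hTAβ_package_semireg_std L α S w₀ hw₀ hsp p hp K e h5β h7β hJ hsgn φ hval e' he'
  exact ⟨K, e, φ, e', Ψ, Ψβ, h1, h3, h4, h5, h6, h7, h8, h10, h5β, h6β, h7β, hφ, hval, he',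
    fun c => fst_std_gprimeTorus_insert_eq_hypBlockGL L α S w₀ p hw₀ hsp hp K e h5β hJ hsgn φ hval e' he' c, hTA, hTAβ, hΨ1, hΨ, hΨβ1, hΨβ⟩

end StageA


/-! ## §2 The Cayley torus `φ(range cD)` is compact abelian — the `[CompactSpace ↥A]`∕`hAcomm` binders of ★ `exists_hmap_hmapβ_descentConst_eq_of_clauses` at `A := φ(range cD)` -/

section CayleyTorus

variable (L : Type) [Field L] [NumberField L] [IsCMField L] (α : Fin 3 → L) (w₀ : {w : InfinitePlace L // IsComplex w})
  {J : Matrix (Fin 2) (Fin 2) ℂ}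
  (φ : ↥(unitaryGroupOfForm (starRingEnd ℂ) ((Matrix.diagonal ![α (lineOf (formSign L α w₀) 0), α (lineOf (formSign L α w₀) 2)]).map w₀.1.embedding)) ≃ₜ* ↥(unitaryGroupOfForm (starRingEnd ℂ) J))

omit [NumberField L] [IsCMField L] in
/-- The Cayley torus `φ(diag(S¹ × S¹))` of `U(J)` is COMPACT (as a subtype; ★ `isCompact_map_circleDiagonal_range`). [cite: Folland1995, §2.2] -/
theorem compactSpace_map_circleDiagonal_range : CompactSpace ↥(Subgroup.map (φ : ↥(unitaryGroupOfForm (starRingEnd ℂ) ((Matrix.diagonal ![α (lineOf (formSign L α w₀) 0), α (lineOf (formSign L α w₀) 2)]).map w₀.1.embedding)) →* ↥(unitaryGroupOfForm (starRingEnd ℂ) J)) ((circleDiagonal 2).codRestrict (unitaryGroupOfForm (starRingEnd ℂ) ((Matrix.diagonal ![α (lineOf (formSign L α w₀) 0), α (lineOf (formSign L α w₀) 2)]).map w₀.1.embedding)) (circleDiagonal_mem_archLocal_diagonal L 2 ![α (lineOf (formSign L α w₀) 0), α (lineOf (formSign L α w₀) 2)] w₀)).range) :=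
  isCompact_iff_compactSpace.mp (isCompact_map_circleDiagonal_range L α w₀ φ)

omit [NumberField L] [IsCMField L] in
/-- The Cayley torus `φ(diag(S¹ × S¹))` of `U(J)` is ABELIAN. [cite: Rogawski1990, §3.6 p. 31] -/
theorem mul_comm_map_circleDiagonal_range (a b : ↥(Subgroup.map (φ : ↥(unitaryGroupOfForm (starRingEnd ℂ) ((Matrix.diagonal ![α (lineOf (formSign L α w₀) 0), α (lineOf (formSign L α w₀) 2)]).map w₀.1.embedding)) →* ↥(unitaryGroupOfForm (starRingEnd ℂ) J)) ((circleDiagonal 2).codRestrict (unitaryGroupOfForm (starRingEnd ℂ) ((Matrix.diagonal ![α (lineOf (formSign L α w₀) 0), α (lineOf (formSign L α w₀) 2)]).map w₀.1.embedding)) (circleDiagonal_mem_archLocal_diagonal L 2 ![α (lineOf (formSign L α w₀) 0), α (lineOf (formSign L α w₀) 2)] w₀)).range)) : a * b = b * a := by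
  obtain ⟨a, ha⟩ := a
  obtain ⟨b, hb⟩ := b
  obtain ⟨a', ⟨u, rfl⟩, rfl⟩ := Subgroup.mem_map.1 ha
  obtain ⟨b', ⟨v, rfl⟩, rfl⟩ := Subgroup.mem_map.1 hb
  apply Subtype.ext
  show φ _ * φ _ = φ _ * φ _
  rw [← map_mul, ← map_mul, ← map_mul, ← map_mul, mul_comm]

end CayleyTorus

end Literature.NumberTheory.Rogawski1990

end
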